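import Summits.NavierStokesRegularity.NavierStokesRegularity.Theorems.SelfMixingDichotomyMixingPayoffAdvectionDiffusionSchwartz
import Summits.NavierStokesRegularity.NavierStokesRegularity.Theorems.SelfMixingDichotomyMixingPayoffAdmissibleDriftHeatClass
import Summits.NavierStokesRegularity.NavierStokesRegularity.Theorems.SelfMixingDichotomyMixingPayoffAdmissibleMinPrinciple
import Summits.NavierStokesRegularity.NavierStokesRegularity.Theorems.SelfMixingDichotomyMixingPayoffDriftHeatBumpFloor
import Summits.NavierStokesRegularity.NavierStokesRegularity.Theorems.SelfMixingDichotomyMixingPayoffTypeIFloorAssembly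
import Literature.Analysis.FluidPDE.DissipatesAtScale
import HarnessLib

set_option linter.dupNamespace false

/-!
# Route SelfMixingDichotomy — crux `CoherentScaleExclusion` (S2, stmt-NavierStokesRegularity-1423),
# line `registered`, kinematic witness G1: drift-generic Type-I coherence

Support file (`--supports stmt-NavierStokesRegularity-1423`) for the registered stub
`kinWitness_typeICoherence_of_windowBounds` of the line
`Cruxes/CoherentScaleExclusion/Lines/birth.lean` (sub-goal G1 of the lead's kinematic witness
against the cascade regime B).

Write `MIX(u, T, x₀, r, δ) = DissipatesAtScale u T x₀ r δ` (every MIX-admissible passive scalar on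
the window `S = [T − r², T − r²/2]` with datum supported in `B_r(x₀)` keeps at most the fraction `δ`
of its `L²` norm). This file is the DRIFT-GENERIC form of the landed T2 `stub_typeICoherence`
(`…CoherentScaleExclusionTypeICoherence.lean`): the Navier–Stokes hypotheses there (classical on
`[0, T)`, Leray–Hopf, decaying datum) enter only through

* the continuity of the drift on `S × ℝ³` (used by the floor assembly F), and
* the `C_b^∞` bounds of the drift on closed windows `[a, b] ⊂ [0, T)` (used by the well-posedness
  W2 `stub_advectionDiffusionSchwartz`),

and both are supplied here directly by the hypothesis `hwin`: for every `0 ≤ a < b < T` the drift is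
jointly `C^∞` on `[a, b] × ℝ³` with all space–time derivatives (within the slab) bounded.

* `kinWitness_typeICoherence_floor` — F re-assembled (adapted from `stub_typeIFloorAssembly`,
  `…MixingPayoffTypeIFloorAssembly.lean`) from the landed F1 `stub_admissibleDriftHeatClass`,
  F2 `stub_admissibleMinPrinciple`, F3 `stub_driftHeatBumpFloor`, with the continuity of the drift
  on the windows `S` (`r² < T`) as a hypothesis instead of `IsClassicalNSSolutionOn`: for every
  `K > 0` there is `c₁(K) > 0` such that under the Type-I(K) bound `√(T − t)‖u(t,x)‖ ≤ K` on a
  parabolic cylinder at `(T, x₀)`, for all small `r` every MIX-admissible scalar with bump datum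
  (`0 ≤ θ₀ ≤ 1`, `θ₀ = 1` on `B̄(x₀, r/2)`, `supp θ₀ ⊆ B(x₀, r)`) satisfies
  `c₁² ∫ θ₀² < ∫ θ(T − r²/2)²`.
* `kinWitness_typeICoherence_of_windowBounds` — the stub: with `δ₁ := c₁(K)`,
  `¬ MIX(u, T, x₀, r, δ)` for all `r` below some `r₂ > 0` and all `0 ≤ δ ≤ δ₁`: launch the
  `ContDiffBump` datum (`rIn = r/2`, `rOut = r`) by W2 on the window (`0 ≤ T − r²` as `r < √T`);
  `MIX(r, δ)` gives `∫ θ(T − r²/2)² ≤ δ² ∫ θ₀² ≤ c₁² ∫ θ₀²`, contradicting the floor.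

No named fact is taken as a hypothesis: everything below is unconditional.
-/

noncomputable section

open Literature.Analysis.FluidPDE MeasureTheory Set Function Metric
open scoped ContDiff

namespace Summit.NavierStokesRegularity.NavierStokesRegularity.Theorems

/-- **F (drift-generic) — the bounded-drift floor under a Type-I bound.** For every `K > 0` there
is `c₁ = c₁(K) > 0` (`c₁ = λ(K)/3`, `λ` from F3 `stub_driftHeatBumpFloor`) such that for a drift
`u` continuous on every window slab `[T − r², T − r²/2] × ℝ³` with `0 < r`, `r² < T`, obeying the
Type-I(K) velocity bound `√(T − t)‖u t x‖ ≤ K` on `(T − r₁², T) × B(x₀, r₁)`, for all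
`r < r₂ := min (r₁/(4+8K)) √T` every MIX-admissible scalar with bump datum keeps strictly more
than the fraction `c₁²` of its `L²` mass. Proof adapted verbatim from `stub_typeIFloorAssembly`
(file `SelfMixingDichotomyMixingPayoffTypeIFloorAssembly.lean`), whose classical-solution
hypothesis is used there only to get the continuity of the drift on the slab: the Type-I bound
gives the drift bound `√2 K / r` on `S × B(x₀, r₁)`; F1 gives membership in the local drift–heat
class over `B(x₀, r₁) ⊇ B̄(x₀, (3 + 8K) r)`, F2 gives `θ ≥ 0`, F3 gives `θ(T − r²/2) ≥ λ` on
`B̄(x₀, r/2)`; then `∫ θ(T−r²/2)² ≥ λ² |B̄_{r/2}| > (λ/3)² |B_r| ≥ c₁² ∫ θ(T−r²)²`. -/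
theorem kinWitness_typeICoherence_floor :
    ∀ K : ℝ, 0 < K → ∃ c₁ : ℝ, 0 < c₁ ∧
    ∀ (T : ℝ) (u : ℝ → EuclideanSpace ℝ (Fin 3) → EuclideanSpace ℝ (Fin 3)), 0 < T →
    (∀ r : ℝ, 0 < r → r ^ 2 < T →
      ContinuousOn (Function.uncurry u) (Set.Icc (T - r ^ 2) (T - r ^ 2 / 2) ×ˢ Set.univ)) →
    ∀ x₀ : EuclideanSpace ℝ (Fin 3),
    (∃ r₁ : ℝ, 0 < r₁ ∧ ∀ t ∈ Set.Ioo (T - r₁ ^ 2) T, ∀ x ∈ Metric.ball x₀ r₁,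
      Real.sqrt (T - t) * ‖u t x‖ ≤ K) →
    ∃ r₂ : ℝ, 0 < r₂ ∧ ∀ r ∈ Set.Ioo 0 r₂, ∀ θ : ℝ → EuclideanSpace ℝ (Fin 3) → ℝ,
      IsSmoothSpaceTimeOn (Set.Icc (T - r ^ 2) (T - r ^ 2 / 2)) θ →
      HasUniformRapidDecayOn (Set.Icc (T - r ^ 2) (T - r ^ 2 / 2)) θ →
      (∀ t ∈ Set.Icc (T - r ^ 2) (T - r ^ 2 / 2), ∀ x : EuclideanSpace ℝ (Fin 3),
        timeDerivWithin (Set.Icc (T - r ^ 2) (T - r ^ 2 / 2)) θ t x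
            + inner ℝ (u t x) (gradient (θ t) x)
          = Laplacian.laplacian (θ t) x) →
      (∀ x, 0 ≤ θ (T - r ^ 2) x) → (∀ x, θ (T - r ^ 2) x ≤ 1) →
      (∀ x ∈ Metric.closedBall x₀ (r / 2), θ (T - r ^ 2) x = 1) →
      Function.support (θ (T - r ^ 2)) ⊆ Metric.ball x₀ r →
      c₁ ^ 2 * ∫ x, (θ (T - r ^ 2) x) ^ 2 < ∫ x, (θ (T - r ^ 2 / 2) x) ^ 2 := by
  -- adapted from `stub_typeIFloorAssembly`
  -- (Theorems/SelfMixingDichotomyMixingPayoffTypeIFloorAssembly.lean): the same assembly, with the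
  -- continuity of the drift on the window slab taken from the hypothesis `hcontT`.
  intro K hK
  -- the constant: a third of the Gaussian floor `λ(K)` of F3
  obtain ⟨lam, hlam, hfloor⟩ := stub_driftHeatBumpFloor K hK
  refine ⟨lam / 3, by positivity, ?_⟩
  intro T u hT hcontT x₀ hTI
  obtain ⟨r₁, hr₁, hTI⟩ := hTI
  -- the floor scale `r₂ = min (r₁/(4 + 8K)) √T`
  have hK4 : 0 < 4 + 8 * K := by positivity
  refine ⟨min (r₁ / (4 + 8 * K)) (Real.sqrt T), lt_min (by positivity) (Real.sqrt_pos.2 hT), ?_⟩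
  intro r hr θ hsm hdec hpde hθ0 hθ1 hone hsupp
  obtain ⟨hr, hrr₂⟩ := hr
  have hrK : r < r₁ / (4 + 8 * K) := hrr₂.trans_le (min_le_left _ _)
  have hrT' : r < Real.sqrt T := hrr₂.trans_le (min_le_right _ _)
  have hr4 : (4 + 8 * K) * r < r₁ := by
    rw [lt_div_iff₀ hK4] at hrK
    linarith
  have hKr : 0 ≤ K * r := by positivity
  have hrr₁ : r < r₁ := by nlinarith
  have h3r : (3 + 8 * K) * r < r₁ := by nlinarith
  have hrT : r ^ 2 < T := by
    have hsq : Real.sqrt T ^ 2 = T := Real.sq_sqrt hT.le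
    nlinarith [Real.sqrt_nonneg T]
  have hr2 : 0 < r ^ 2 := by positivity
  have hr12 : r ^ 2 < r₁ ^ 2 := by nlinarith
  -- (i) the drift is continuous on `S × ℝ³` (hypothesis, as `0 < r`, `r² < T`)
  have hcont : ContinuousOn (Function.uncurry u)
      (Set.Icc (T - r ^ 2) (T - r ^ 2 / 2) ×ˢ Set.univ) := hcontT r hr hrT
  -- (ii) the Type-I bound gives the drift bound `√2 K / r` on `S × B(x₀, r₁)`
  have hbound : ∀ t ∈ Set.Icc (T - r ^ 2) (T - r ^ 2 / 2), ∀ x ∈ Metric.ball x₀ r₁,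
      ‖u t x‖ ≤ Real.sqrt 2 * K / r := by
    intro t ht x hx
    have htI : t ∈ Set.Ioo (T - r₁ ^ 2) T := ⟨by linarith [ht.1], by linarith [ht.2]⟩
    exact typeIFloor_norm_le_of_typeI hr (by linarith [ht.2]) (hTI t htI x hx)
  -- (iii) F1: membership in the local drift–heat class over `U = B(x₀, r₁)`
  obtain ⟨a, ha⟩ :=
    stub_admissibleDriftHeatClass T r u θ hr hcont hsm hpde (Real.sqrt 2 * K / r)
      (Metric.ball x₀ r₁) hbound
  -- (iv) F2: nonnegativity on the window
  have hpos : ∀ t ∈ Set.Icc (T - r ^ 2) (T - r ^ 2 / 2), ∀ x : EuclideanSpace ℝ (Fin 3),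
      0 ≤ θ t x :=
    stub_admissibleMinPrinciple T r u θ hr hsm hdec hpde hθ0
  -- (v) F3: the floor `λ` on `B̄(x₀, r/2)` at the final time
  have hsub : Metric.closedBall x₀ ((3 + 8 * K) * r) ⊆ Metric.ball x₀ r₁ :=
    closedBall_subset_ball h3r
  have hlow : ∀ x ∈ Metric.closedBall x₀ (r / 2), lam ≤ θ (T - r ^ 2 / 2) x :=
    hfloor a θ x₀ T r hr (Metric.ball x₀ r₁) isOpen_ball hsub ha hpos hone
  -- (vi) integrability of the final squared slice
  have htS : T - r ^ 2 / 2 ∈ Set.Icc (T - r ^ 2) (T - r ^ 2 / 2) := ⟨by linarith, le_rfl⟩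
  have hint : Integrable (fun x => (θ (T - r ^ 2 / 2) x) ^ 2) :=
    typeIFloor_integrable_sq_slice hsm hdec htS
  -- (vii) the `L²` accounting
  set V : ℝ := (volume : Measure (EuclideanSpace ℝ (Fin 3))).real
      (Metric.ball (0 : EuclideanSpace ℝ (Fin 3)) 1) with hV
  have hV0 : 0 < V := by
    rw [hV, measureReal_def]
    exact ENNReal.toReal_pos (measure_ball_pos volume _ one_pos).ne' measure_ball_lt_top.ne
  have hI0 : ∫ x, (θ (T - r ^ 2) x) ^ 2 ≤ r ^ 3 * V :=
    typeIFloor_integral_sq_le_of_bump hr.le hθ0 hθ1 hsupp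
  have hI1 : lam ^ 2 * ((r / 2) ^ 3 * V) ≤ ∫ x, (θ (T - r ^ 2 / 2) x) ^ 2 :=
    typeIFloor_le_integral_sq_of_floor hr.le hlam.le hint hlow
  have hgap : 0 < lam ^ 2 * (r ^ 3 * V) := by positivity
  calc (lam / 3) ^ 2 * ∫ x, (θ (T - r ^ 2) x) ^ 2 ≤ (lam / 3) ^ 2 * (r ^ 3 * V) :=
        mul_le_mul_of_nonneg_left hI0 (sq_nonneg _)
    _ < lam ^ 2 * ((r / 2) ^ 3 * V) := by nlinarith
    _ ≤ ∫ x, (θ (T - r ^ 2 / 2) x) ^ 2 := hI1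

/-- **G1 — drift-generic Type-I coherence** (registered stub
`kinWitness_typeICoherence_of_windowBounds` of the crux `CoherentScaleExclusion`, kinematic
witness package). For every `K > 0` there is `δ₁ = δ₁(K) > 0` (the floor constant `c₁(K)` of
`kinWitness_typeICoherence_floor`) such that for every `T > 0`, every drift `u` that is jointly
`C^∞` with all space–time derivatives bounded on every closed window slab `[a, b] × ℝ³`,
`0 ≤ a < b < T` (hypothesis `hwin`; no Navier–Stokes structure is assumed), and every `x₀` at
which the Type-I(K) velocity bound `√(T − t)‖u(t,x)‖ ≤ K` holds on some parabolic cylinder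
`(T − r₁², T) × B(x₀, r₁)`, there is `r₂ > 0` with `¬ DissipatesAtScale u T x₀ r δ` for all
`r ∈ (0, r₂)` and all `0 ≤ δ ≤ δ₁`. Proof (as for `stub_typeICoherence`): the floor gives a scale
`r₂'` (the continuity of `u` on the slabs `[T − r², T − r²/2] × ℝ³`, `r² < T`, is the first
conjunct of `hwin`); put `r₂ := min r₂' √T`; at such `r` the window lies in `[0, T)`, so W2
`stub_advectionDiffusionSchwartz` (fed with both conjuncts of `hwin`) launches the MIX-admissible
scalar `θ` from the `ContDiffBump` datum centred at `x₀` (`rIn = r/2`, `rOut = r`); `MIX(r, δ)`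
says `∫ θ(T − r²/2)² ≤ δ² ∫ θ(T − r²)² ≤ c₁² ∫ θ(T − r²)²`, while the floor says
`c₁² ∫ θ(T − r²)² < ∫ θ(T − r²/2)²` — contradiction. -/
theorem kinWitness_typeICoherence_of_windowBounds : ∀ K : ℝ, 0 < K → ∃ δ₁ : ℝ, 0 < δ₁ ∧ ∀ T : ℝ, 0 < T → ∀ (u : ℝ → EuclideanSpace ℝ (Fin 3) → EuclideanSpace ℝ (Fin 3)), (∀ a b : ℝ, 0 ≤ a → a < b → b < T → Literature.Analysis.FluidPDE.IsSmoothSpaceTimeOn (Set.Icc a b) u ∧ ∀ n : ℕ, ∃ C : ℝ, ∀ t ∈ Set.Icc a b, ∀ x : EuclideanSpace ℝ (Fin 3), ‖iteratedFDerivWithin ℝ n (Function.uncurry u) (Set.Icc a b ×ˢ Set.univ) (t, x)‖ ≤ C) → ∀ x₀ : EuclideanSpace ℝ (Fin 3), (∃ r₁ : ℝ, 0 < r₁ ∧ ∀ t ∈ Set.Ioo (T - r₁ ^ 2) T, ∀ x ∈ Metric.ball x₀ r₁, Real.sqrt (T - t) * ‖u t x‖ ≤ K) → ∃ r₂ : ℝ,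 0 < r₂ ∧ ∀ r ∈ Set.Ioo 0 r₂, ∀ δ : ℝ, 0 ≤ δ → δ ≤ δ₁ → ¬ Literature.Analysis.FluidPDE.DissipatesAtScale u T x₀ r δ := by
  intro K hK
  -- F: the floor constant `c₁(K)`; we take `δ₁ := c₁`.
  obtain ⟨c₁, hc₁, hF⟩ := kinWitness_typeICoherence_floor K hK
  refine ⟨c₁, hc₁, ?_⟩
  intro T hT u hwin x₀ hTI
  -- the drift is continuous on every window slab inside `[0, T)` (first conjunct of `hwin`)
  have hcontT : ∀ r : ℝ, 0 < r → r ^ 2 < T →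
      ContinuousOn (Function.uncurry u) (Set.Icc (T - r ^ 2) (T - r ^ 2 / 2) ×ˢ Set.univ) := by
    intro r hr hrT
    have hr2 : 0 < r ^ 2 := by positivity
    exact (hwin (T - r ^ 2) (T - r ^ 2 / 2) (by linarith) (by linarith)
      (by linarith)).1.continuousOn
  -- F at the Type-I(K) point: the floor scale `r₂'`.
  obtain ⟨r₂', hr₂', hfl⟩ := hF T u hT hcontT x₀ hTI
  refine ⟨min r₂' (Real.sqrt T), lt_min hr₂' (Real.sqrt_pos.2 hT), ?_⟩
  intro r hr δ hδ₀ hδ₁ hmix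
  obtain ⟨hr₀, hrlt⟩ := hr
  have hrr₂ : r < r₂' := hrlt.trans_le (min_le_left _ _)
  have hrT : r ^ 2 < T := by
    have h : r ^ 2 < Real.sqrt T ^ 2 :=
      pow_lt_pow_left₀ (hrlt.trans_le (min_le_right _ _)) hr₀.le two_ne_zero
    rwa [Real.sq_sqrt hT.le] at h
  -- W2: the admissible scalar launched by the bump datum centred at `x₀` (both conjuncts of `hwin`
  -- on the window `[T - r², T - r²/2] ⊂ [0, T)`).
  have hr2 : 0 < r ^ 2 := by positivity
  have ha : (0 : ℝ) ≤ T - r ^ 2 := by linarith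
  have hab : T - r ^ 2 < T - r ^ 2 / 2 := by linarith
  have hb : T - r ^ 2 / 2 < T := by linarith
  obtain ⟨hsmu, hbdu⟩ := hwin (T - r ^ 2) (T - r ^ 2 / 2) ha hab hb
  let φ : ContDiffBump x₀ := ⟨r / 2, r, by positivity, by linarith⟩
  obtain ⟨θ, hsm, hdecay, hpde, hθ₀⟩ :=
    stub_advectionDiffusionSchwartz (T - r ^ 2) (T - r ^ 2 / 2) hab u hsmu hbdu φ φ.contDiff
      φ.hasCompactSupport
  have hsupp : Function.support (θ (T - r ^ 2)) ⊆ Metric.ball x₀ r := by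
    rw [hθ₀, φ.support_eq]
  -- `MIX(r, δ)` on `θ` versus the floor on `θ`.
  have hM : ∫ x, (θ (T - r ^ 2 / 2) x) ^ 2 ≤ δ ^ 2 * ∫ x, (θ (T - r ^ 2) x) ^ 2 :=
    hmix θ hsm hdecay hpde hsupp
  have hL : c₁ ^ 2 * ∫ x, (θ (T - r ^ 2) x) ^ 2 < ∫ x, (θ (T - r ^ 2 / 2) x) ^ 2 :=
    hfl r ⟨hr₀, hrr₂⟩ θ hsm hdecay hpde
      (fun x => by rw [hθ₀]; exact φ.nonneg)
      (fun x => by rw [hθ₀]; exact φ.le_one)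
      (fun x hx => by rw [hθ₀]; exact φ.one_of_mem_closedBall hx)
      hsupp
  have hX : 0 ≤ ∫ x, (θ (T - r ^ 2) x) ^ 2 := integral_nonneg fun _ => sq_nonneg _
  have hδc : δ ^ 2 ≤ c₁ ^ 2 := pow_le_pow_left₀ hδ₀ hδ₁ 2
  have hlt : c₁ ^ 2 * ∫ x, (θ (T - r ^ 2) x) ^ 2 < c₁ ^ 2 * ∫ x, (θ (T - r ^ 2) x) ^ 2 :=
    hL.trans_le (hM.trans (mul_le_mul_of_nonneg_right hδc hX))
  exact lt_irrefl _ hlt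

end Summit.NavierStokesRegularity.NavierStokesRegularity.Theorems

end
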